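import Literature.NumberTheory.EllipticCurves.Kato2004.ZetaLineRankOneRigidityProofs
import Literature.NumberTheory.EllipticCurves.Kato2004.IwasawaCohomologyUniqueProofs
import HarnessLib

/-!
# Character functionals on the pinned Iwasawa cohomology `𝐇¹_Γ(T_pW)` from FINITE-LEVEL
# `χ`-eigenfunctionals on `H¹(ℚ_n, T_pW)` — Kato 2004, §12.2/§13.8 (the `Λ`-action is levelwise) with
# Thm. 12.5 (1) in view: `w ∘ proj_n` is `Λ`-semilinear through the character point `χ(γ) − 1`
# (proofs only; the input of `Kato2004.lengthAt_quotient_span_eq_of_characterValues_proportional`)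

K. Kato, *`p`-adic Hodge theory and values of zeta functions of modular forms*, Astérisque **295**
(2004) [Kato2004Asterisque]: §12.2 (p. 220) and §13.8 (p. 228) — `𝐇¹(T) = lim←_n H¹(ℤ[ζ_{p^n},1/p], T)`
with its `O_λ[[G_∞]]`-structure "through the second factor" of `T ⊗ O_λ[G_n]`, i.e. at level `n` the
algebra acts through `O_λ[G_n] = O_λ[X]/(ω_n)`; Thm. 12.5 (1) (p. 221) — the values of a `Λ`-adic class
at the layers: "the map `S(f) ⊗ ℚ(ζ_{p^n}) → V_F(f)`, `x ⊗ y ↦ ∑_{σ ∈ G_n} χ(σ) σ(y) per_f(x)^±`"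
applied to the dual exponential of the level-`n` component — a `χ`-WEIGHTED SUM over `G_n`, hence a
functional on `H¹(ℚ_n, ·)` on which `γ` acts through the root of unity `χ(γ)`.

THIS FILE (cell `bsd-2adic`, crux stmt-BirchSwinnertonDyer-19098 `AdditiveRankZeroAtTwo`, seat
`bsd-2adic-addL2x` GEN 19; reading step T22 (b) of the descent sockets, after the kernel skeleton
`Kato2004/ZetaLineRankOneRigidityProofs.lean`, p740449) supplies the one remaining piece of ALGEBRA in
that step: the skeleton takes, for cofinitely many characters `χ`, an additive functional `v_χ` on the
pinned `𝐇¹_Γ` that is `Λ`-SEMILINEAR through `χ` — `v_χ(a • x) = a(χ(γ₀) − 1)·v_χ(x)` for EVERY power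
series `a ∈ Λ = ℤ_p⟦T⟧` (an infinite sum in `ℂ_p`). Here we prove that such a functional is AUTOMATIC
from finite-level data: for a pin `I : IwasawaH1Data W p κ γ` (`γ` a topological generator), a level
`n`, a root of unity `ζ ∈ ℂ_p` with `ζ^{p^n} = 1`, and an additive, `ℤ_p`-semilinear functional
`w : H¹(ℚ_n, T_pW) → ℂ_p` which is a `ζ`-EIGENFUNCTIONAL for `conj_γ` (`w(conj_γ y) = ζ·w(y)`), the
composite `w ∘ proj_n` satisfies `w(proj_n(a • x)) = a(ζ − 1)·w(proj_n x)` for every `a ∈ Λ`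
(`IwasawaH1Data.apply_proj_smul_eq_tsum_mul`). Proof: the `Λ`-action of ANY pin is levelwise
(`IwasawaH1Data.proj_smul`: `proj_n(a • x) = r(conj_γ − 1)(proj_n x)` for a polynomial `r ≡ a mod ω_n`,
Weierstrass division by `ω_n = (1+T)^{p^n} − 1`, `IwasawaH1Exists.exists_polynomial_sub_coe_mem_span`); a
`ζ`-eigenfunctional turns `r(conj_γ − 1)` into the scalar `r(ζ − 1)`; and `a(ζ−1) = r(ζ−1)` because
`ω_n(ζ − 1) = ζ^{p^n} − 1 = 0` (evaluation on the open disc is additive and multiplicative,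
`tsum_map_coeff_mul_mul_pow`). Consequently (`IwasawaH1Data.lengthAt_quotient_span_eq_of_layerFunctionals`)
the T22 (b) skeleton holds with FINITE-LEVEL hypotheses: two non-zero classes `z, z̃` of `𝐇¹_Γ(T_pW)`
(torsion free of rank `1`: `Kato2004.thm12_4`) generate the same line at every prime `𝔮 ∌ p` of `Λ` as
soon as, for all primitive characters `χ` of `Γ` off a finite set, some level `n` with `χ(γ₀)^{p^n} = 1`
carries a `χ(γ₀)`-eigenfunctional `w` (additive, `ℤ_p`-semilinear) with `w(proj_n z) ≠ 0` and
`α·w(proj_n z̃) = β·w(proj_n z)` for fixed `α, β ∈ ℂ_p^×`. What remains OUTSIDE the kernel in T22 (b)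
is then exactly: such eigenfunctionals exist with these values — Kato Thm. 12.5 (1) (the `χ`-sum of the
dual exponential; its eigen-property is the Galois-equivariance of `exp*`) for the two newforms, one
period ratio, and Rohrlich's non-vanishing (Kato 13.5 (2); tree fact
`Rohrlich1988_nonvanishing_twists_anyLevel`). Theorems only; no definition, no named fact; nothing about
BSD is claimed; `W`, `p`, `κ`, `γ` arbitrary.

References: [Kato2004Asterisque] §12.2 (p. 220), Thm. 12.4 (2), Thm. 12.5 (1) (p. 221), 13.5 (2)
(p. 227), §13.8 (p. 228); [Washington1997] §7.2 (the points `ζ − 1`), Prop. 7.2 (division by `ω_n`);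
[Lang1990] Ch. 5 §1 Thm. 1.1 (`Λ = lim← O[X]/(ω_n)`); [MazurTateTeitelbaum1986Invent] §I.13.
-/

noncomputable section

open scoped Classical
open CategoryTheory Polynomial Field
open Literature.NumberTheory.GaloisRepresentations
open Literature.NumberTheory.EllipticCurves.Kato2004.EulerSystemValues

namespace Literature.NumberTheory.EllipticCurves.Kato2004

namespace IwasawaH1Data

variable {W : WeierstrassCurve ℚ} [W.IsElliptic] {p : ℕ} [Fact p.Prime]
  [ContinuousSMul ℤ_[p] (W.tateModule p)] {κ : ZpExtension ℚ p} {γ : absoluteGaloisGroup ℚ}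
  (I : IwasawaH1Data W p κ γ)

/-- **A `ζ`-eigenfunctional turns the levelwise polynomial action into a scalar.** If `w` is an
additive functional on the `n`-th layer `H¹(ℚ_n, T_pW)`, `ℤ_p`-semilinear (`w(c • y) = c·w(y)`) and a
`ζ`-eigenfunctional for `conj_γ` (`w(conj_γ y) = ζ·w(y)`), then for every polynomial `r ∈ ℤ_p[X]`,
`w(r(conj_γ − 1) y) = r(ζ − 1)·w(y)` (induction on `r`; Kato §13.8: at level `n` the algebra acts through
`O_λ[G_n]`, on whose `χ`-part `γ` is the scalar `χ(γ)`). [cite: Kato2004Asterisque, §13.8 (p. 228)] -/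
theorem apply_aeval_conj_sub_one_eq (n : ℕ) {ζ : ℂ_[p]}
    (w : H1 (tateRep W p) (κ.layerSubgroup n) →+ ℂ_[p])
    (hw_smul : ∀ (c : ℤ_[p]) (y : H1 (tateRep W p) (κ.layerSubgroup n)),
      w (c • y) = ((algebraMap ℚ_[p] ℂ_[p]).comp (algebraMap ℤ_[p] ℚ_[p])) c * w y)
    (hw_conj : ∀ y : H1 (tateRep W p) (κ.layerSubgroup n),
      w ((conjMap (tateRep W p).toTopRep (κ.layerSubgroup n) γ 1).hom.toLinearMap y) = ζ * w y)
    (r : ℤ_[p][X]) (y : H1 (tateRep W p) (κ.layerSubgroup n)) :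
    w (aeval ((conjMap (tateRep W p).toTopRep (κ.layerSubgroup n) γ 1).hom.toLinearMap - 1) r y) =
      r.eval₂ ((algebraMap ℚ_[p] ℂ_[p]).comp (algebraMap ℤ_[p] ℚ_[p])) (ζ - 1) * w y := by
  set θ : Module.End ℤ_[p] (H1 (tateRep W p) (κ.layerSubgroup n)) :=
    (conjMap (tateRep W p).toTopRep (κ.layerSubgroup n) γ 1).hom.toLinearMap with hθ
  set ι : ℤ_[p] →+* ℂ_[p] := (algebraMap ℚ_[p] ℂ_[p]).comp (algebraMap ℤ_[p] ℚ_[p]) with hι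
  induction r using Polynomial.induction_on generalizing y with
  | C c =>
    rw [aeval_C, Module.algebraMap_end_apply, hw_smul, eval₂_C]
  | add f g hf hg =>
    rw [map_add, LinearMap.add_apply, map_add w, hf, hg, eval₂_add, add_mul]
  | monomial k c hk =>
    rw [pow_succ, ← mul_assoc, map_mul, Module.End.mul_apply, aeval_X, hk, LinearMap.sub_apply,
      Module.End.one_apply, map_sub w, hw_conj]
    simp only [eval₂_mul, eval₂_X]
    ring

/-- **Character functionals on `𝐇¹_Γ(T_pW)` from finite-level eigenfunctionals.** Let `γ` be a
topological generator, `n` a level, `ζ ∈ ℂ_p` with `ζ^{p^n} = 1`, and `w : H¹(ℚ_n, T_pW) → ℂ_p` additive,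
`ℤ_p`-semilinear and a `ζ`-eigenfunctional for `conj_γ`. Then for EVERY `a ∈ Λ = ℤ_p⟦T⟧` and `x ∈ 𝐇¹_Γ`,
`w(proj_n(a • x)) = a(ζ − 1)·w(proj_n x)`, `a(ζ − 1) = ∑_i a_i (ζ − 1)^i ∈ ℂ_p`. The `Λ`-action is
levelwise (`IwasawaH1Data.proj_smul` with a polynomial `r ≡ a (mod ω_n)`,
`IwasawaH1Exists.exists_polynomial_sub_coe_mem_span`), the eigenfunctional evaluates `r(conj_γ − 1)` to
`r(ζ − 1)` (`apply_aeval_conj_sub_one_eq`), and `a(ζ − 1) = r(ζ − 1)` since `ω_n(ζ − 1) = ζ^{p^n} − 1 = 0`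
and evaluation on the open unit disc of `ℂ_p` is additive and multiplicative. This is the
`Λ`-semilinearity hypothesis of `Kato2004.lengthAt_quotient_span_eq_of_characterValues_proportional`
for `v = w ∘ proj_n`. [cite: Kato2004Asterisque, §12.2 (p. 220), §13.8 (p. 228), Thm. 12.5 (1) (p. 221)]
[cite: Washington1997, §7.2 and Prop. 7.2] -/
theorem apply_proj_smul_eq_tsum_mul (hγ : κ.IsTopGenerator γ) (n : ℕ) {ζ : ℂ_[p]}
    (hζ : ζ ^ p ^ n = 1) (w : H1 (tateRep W p) (κ.layerSubgroup n) →+ ℂ_[p])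
    (hw_smul : ∀ (c : ℤ_[p]) (y : H1 (tateRep W p) (κ.layerSubgroup n)),
      w (c • y) = ((algebraMap ℚ_[p] ℂ_[p]).comp (algebraMap ℤ_[p] ℚ_[p])) c * w y)
    (hw_conj : ∀ y : H1 (tateRep W p) (κ.layerSubgroup n),
      w ((conjMap (tateRep W p).toTopRep (κ.layerSubgroup n) γ 1).hom.toLinearMap y) = ζ * w y)
    (a : IwasawaAlgebra p) (x : I.H) :
    w (I.proj n (a • x)) =
      (∑' i, ((algebraMap ℚ_[p] ℂ_[p]).comp (algebraMap ℤ_[p] ℚ_[p])) (PowerSeries.coeff i a) *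
        (ζ - 1) ^ i) * w (I.proj n x) := by
  set ι : ℤ_[p] →+* ℂ_[p] := (algebraMap ℚ_[p] ℂ_[p]).comp (algebraMap ℤ_[p] ℚ_[p]) with hι
  have hbd : ∀ (A : IwasawaAlgebra p) (k : ℕ), ‖ι (PowerSeries.coeff k A)‖ ≤ 1 :=
    norm_algebraMap_coeff_le_one
  have hzn : ‖ζ - 1‖ < 1 := norm_sub_one_lt_one_of_pow_prime_pow_eq_one (j := n) hζ
  -- Weierstrass division by `ω_n`
  set Ω : ℤ_[p][X] := (X + 1 : ℤ_[p][X]) ^ p ^ n - 1 with hΩ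
  obtain ⟨r, hr⟩ := IwasawaH1Exists.exists_polynomial_sub_coe_mem_span p n a
  obtain ⟨q, hq⟩ := Ideal.mem_span_singleton'.mp hr
  have ha : a = (r : PowerSeries ℤ_[p]) + (Ω : PowerSeries ℤ_[p]) * q := by
    rw [hΩ, mul_comm, hq, add_sub_cancel]
  -- the levelwise action and the eigenfunctional
  rw [I.proj_smul hγ n hr, apply_aeval_conj_sub_one_eq n w hw_smul hw_conj r (I.proj n x)]
  congr 1
  -- `a(ζ − 1) = r(ζ − 1)`: `Ω(ζ − 1) = ζ^{p^n} − 1 = 0`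
  have hΩval : HasSum (fun k ↦ ι (PowerSeries.coeff k (Ω : PowerSeries ℤ_[p])) * (ζ - 1) ^ k) 0 := by
    have h := hasSum_map_coeff_coe_mul_pow ι Ω (ζ - 1)
    rwa [hΩ, eval₂_sub, eval₂_pow, eval₂_add, eval₂_X, eval₂_one, sub_add_cancel, hζ, sub_self] at h
  have hΩq : HasSum (fun k ↦ ι (PowerSeries.coeff k ((Ω : PowerSeries ℤ_[p]) * q)) * (ζ - 1) ^ k) 0 := by
    have hs := (summable_map_coeff_mul_pow ι (hbd ((Ω : PowerSeries ℤ_[p]) * q)) hzn).hasSum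
    rwa [tsum_map_coeff_mul_mul_pow ι (hbd _) (hbd q) hzn, hΩval.tsum_eq, zero_mul] at hs
  have hrval := hasSum_map_coeff_coe_mul_pow ι r (ζ - 1)
  have hsum : HasSum (fun k ↦ ι (PowerSeries.coeff k a) * (ζ - 1) ^ k) (r.eval₂ ι (ζ - 1) + 0) := by
    refine (hrval.add hΩq).congr_fun fun k ↦ ?_
    rw [ha, map_add, map_add, add_mul]
  rw [hsum.tsum_eq, add_zero]

/-- **T22 (b) with FINITE-LEVEL hypotheses (the consumer shape).** Let `I : IwasawaH1Data W p κ γ` be a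
pin with `γ` a topological generator of the cyclotomic `κ`, `z, z̃ ∈ 𝐇¹_Γ(T_pW)` non-zero, `α, β ∈ ℂ_p^×`,
and suppose that for every primitive character `χ` of `Γ` of `p`-power order whose point
`χ(γ₀) − 1` (`γ₀ = cyclotomicGenerator p`) lies outside a finite set `S`, some layer `n` with
`χ(γ₀)^{p^n} = 1` carries an additive, `ℤ_p`-semilinear `χ(γ₀)`-EIGENFUNCTIONAL `w` for `conj_γ` on
`H¹(ℚ_n, T_pW)` with `w(proj_n z) ≠ 0` and `α·w(proj_n z̃) = β·w(proj_n z)` (Kato Thm. 12.5 (1): the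
`χ`-sum of the dual exponential, with values `L(f, χ, 1)·period`; non-vanishing by 13.5 (2)). Then,
granted `Kato2004.thm12_4` (Thm. 12.4 (2): `𝐇¹_Γ` torsion free of rank `1`), `ℓ_𝔮(𝐇¹/Λz̃) = ℓ_𝔮(𝐇¹/Λz)` at
every prime `𝔮 ∌ p` of `Λ`: `apply_proj_smul_eq_tsum_mul` makes `w ∘ proj_n` a character functional, and
`Kato2004.lengthAt_quotient_span_eq_of_characterValues_proportional` concludes. Conditional on `h12`.
[cite: Kato2004Asterisque, Thm. 12.4 (2), Thm. 12.5 (1)(2) (pp. 221–222), 13.5 (2) (p. 227), §13.8 (p. 228)]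
[cite: MazurTateTeitelbaum1986Invent, §I.12–I.14] -/
theorem lengthAt_quotient_span_eq_of_layerFunctionals (h12 : thm12_4) (hκ : κ.IsCyclotomic)
    (hγ : κ.IsTopGenerator γ) {z z' : I.H} (hz : z ≠ 0) (hz' : z' ≠ 0) {α β : ℂ_[p]} (hα : α ≠ 0)
    (hβ : β ≠ 0) (S : Finset ℂ_[p])
    (hw : ∀ m : ℕ, 0 < m → ∀ χ : DirichletCharacter ℂ_[p] (p ^ m), χ.IsPrimitive → χ.Even →
      (∃ j : ℕ, orderOf χ = p ^ j) → (χ (cyclotomicGenerator p : ZMod (p ^ m)) - 1) ∉ S →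
      ∃ (n : ℕ) (w : H1 (tateRep W p) (κ.layerSubgroup n) →+ ℂ_[p]),
        χ (cyclotomicGenerator p : ZMod (p ^ m)) ^ p ^ n = 1 ∧
        (∀ (c : ℤ_[p]) (y : H1 (tateRep W p) (κ.layerSubgroup n)),
          w (c • y) = ((algebraMap ℚ_[p] ℂ_[p]).comp (algebraMap ℤ_[p] ℚ_[p])) c * w y) ∧
        (∀ y : H1 (tateRep W p) (κ.layerSubgroup n),
          w ((conjMap (tateRep W p).toTopRep (κ.layerSubgroup n) γ 1).hom.toLinearMap y) =
            χ (cyclotomicGenerator p : ZMod (p ^ m)) * w y) ∧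
        w (I.proj n z) ≠ 0 ∧ α * w (I.proj n z') = β * w (I.proj n z))
    (𝔮 : PrimeSpectrum (IwasawaAlgebra p)) (hp𝔮 : PowerSeries.C (p : ℤ_[p]) ∉ 𝔮.asIdeal) :
    Module.lengthAt (IwasawaAlgebra p) (I.H ⧸ Submodule.span (IwasawaAlgebra p) {z'}) 𝔮 =
      Module.lengthAt (IwasawaAlgebra p) (I.H ⧸ Submodule.span (IwasawaAlgebra p) {z}) 𝔮 := by
  obtain ⟨-, ⟨htf, hrk⟩, -⟩ := h12 W p κ γ hκ hγ I
  haveI := htf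
  refine lengthAt_quotient_span_eq_of_characterValues_proportional hrk.le hz hz' hα hβ S
    (fun m hm χ hχp hχe hχo htS ↦ ?_) 𝔮 hp𝔮
  obtain ⟨n, w, hζ, hw_smul, hw_conj, hwz, hprop⟩ := hw m hm χ hχp hχe hχo htS
  refine ⟨w.comp (I.proj n), fun a x ↦ ?_, ?_, ?_⟩
  · simp only [AddMonoidHom.coe_comp, Function.comp_apply]
    exact I.apply_proj_smul_eq_tsum_mul hγ n hζ w hw_smul hw_conj a x
  · simpa only [AddMonoidHom.coe_comp, Function.comp_apply] using hwz
  · simpa only [AddMonoidHom.coe_comp, Function.comp_apply] using hprop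

end IwasawaH1Data

end Literature.NumberTheory.EllipticCurves.Kato2004

end
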